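import Summits.ResolutionOfSingularities.ResolutionOfSingularities.Theorems.EquisingularLiftEquisingularLiftNatSpecimenWhitneyCubicForms
import Literature.AlgebraicGeometry.Motives.HypersurfaceCharts
import Literature.AlgebraicGeometry.Motives.HypersurfaceChartAlgebra
import Literature.AlgebraicGeometry.Motives.HypersurfaceFormsIrreducible
import Literature.AlgebraicGeometry.Motives.SmoothHypersurfaceIrreducible
import Literature.AlgebraicGeometry.Resolution.ComponentGluing
import Mathlib.Algebra.MvPolynomial.PDeriv
import HarnessLib

/-!
# [OURS · L1 W4.5(b)] EL♮ specimen family T-ISO-CONE — the FERMAT CONES: the form `F_d = x₁ᵈ + x₂ᵈ + x₃ᵈ` and the integral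
# hypersurface `H_d = V₊(F_d) ⊂ ℙ³_k` (crux `Theses.EquisingularLift.EquisingularLiftNat`, stmt-ResolutionOfSingularities-20038)

NOT a statement of any manuscript; OURS kernel specimen (cell `res-hironaka`, chain w45b, CHAIN v7.4 §3 row T-ISO-1, step 0;
seat res-D-pv-013, own initiative, counted 0). AI-written, weaker than expert review.

The specimen `H_d = V₊(F_d) ⊂ ℙ³_k`, `F_d = x₁ᵈ + x₂ᵈ + x₃ᵈ` — the cone with vertex `[1:0:0:0]` over the Fermat plane curve of
degree `d` — over a field `k` (algebraically closed with `d ≠ 0` in `k` where primality is used), as an instance of the binders of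
the item `EquisingularLiftNat`: `H_d` is the tree's REDUCED hypersurface `Motives.SmoothHypersurface.hypersurface F_d` with its closed
immersion `hypersurfaceι F_d` onto `V₊(F_d)` (Hartshorne II Example 3.2.6); `F_d` is prime, so `H_d` is INTEGRAL. The only
definition is the form; the dehomogenized chart equations are written out: `F_d(x₀ := 1) = y₀ᵈ + y₁ᵈ + y₂ᵈ` (vertex chart) and
`F_d(x_c := 1) = 1 + y₁ᵈ + y₂ᵈ` for `c ≥ 1` (the regular charts of `…NatSpecimenFermatConeAlgebra`).

* `form`, `isHomogeneous_form`, `finSuccEquiv_rename_form`, `prime_form` (Eisenstein in `x₁` at the point `(0, ζ, 1)` of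
  `k[x₀, x₂, x₃]`, `ζᵈ = −1`, via the tree's `irreducible_X_pow_add_C`);
* `dehomogenize_form_zero/one/two/three`, `dehomogenize_form_of_ne_zero`;
* `isReduced_hypersurface`, `isIntegral_hypersurface`.

References: Hartshorne 1977 I Ex. 5.5, II Ex. 2.9, II Example 3.2.6; res-D-pv-022's R2 forms file (…NatSpecimenWhitneyCubicForms,
p508519) whose pattern this follows; the cited tree files.
-/

set_option linter.dupNamespace false -- mandated namespace `Summit.<Summit>.<Problem>` of this single-conjunct summit

noncomputable section

open MvPolynomial HomogeneousLocalization
open Literature.AlgebraicGeometry.Motives Literature.AlgebraicGeometry.Motives.SmoothHypersurface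
open Literature.AlgebraicGeometry.Motives.ProjectiveSpace

namespace Summit.ResolutionOfSingularities.ResolutionOfSingularities.Cruxes.EquisingularLiftNat.Sections

namespace FermatCone

variable (k : Type) [Field k] (d : ℕ)

attribute [local instance] MvPolynomial.gradedAlgebra ProjBaseChange.algebraBase

/-! ## The form `F_d = x₁ᵈ + x₂ᵈ + x₃ᵈ` -/

/-- **The Fermat cone form** `F_d = x₁ᵈ + x₂ᵈ + x₃ᵈ ∈ k[x₀, x₁, x₂, x₃]` (the cone with vertex `[1:0:0:0]` over the Fermat plane
curve of degree `d`). [folklore] -/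
def form : MvPolynomial (Fin 4) k := X 1 ^ d + X 2 ^ d + X 3 ^ d

/-- `F_d` is homogeneous of degree `d`. [folklore] -/
theorem isHomogeneous_form : (form k d).IsHomogeneous d := by
  have h : ∀ i : Fin 4, ((X i : MvPolynomial (Fin 4) k) ^ d).IsHomogeneous d := fun i => by
    simpa using (isHomogeneous_X k i).pow d
  exact ((h 1).add (h 2)).add (h 3)

/-- In `x₀`-adic form after `x₀ ↔ x₁`: `F_d(x₁, x₀, x₂, x₃) = Yᵈ + C(y₁ᵈ + y₂ᵈ)` over `k[y₀, y₁, y₂]` (`y = (x₁, x₂, x₃)`).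
[folklore] -/
theorem finSuccEquiv_rename_form :
    finSuccEquiv k 3 (rename (Equiv.swap (0 : Fin 4) 1) (form k d)) =
      Polynomial.X ^ d + Polynomial.C (X 1 ^ d + X 2 ^ d) := by
  have h2 : finSuccEquiv k 3 (X 2) = Polynomial.C (X 1) := finSuccEquiv_X_succ (j := 1)
  have h3 : finSuccEquiv k 3 (X 3) = Polynomial.C (X 2) := finSuccEquiv_X_succ (j := 2)
  simp only [form, map_add, map_pow, rename_X, Equiv.swap_apply_right,
    Equiv.swap_apply_of_ne_of_ne (show (2 : Fin 4) ≠ 0 by decide) (show (2 : Fin 4) ≠ 1 by decide),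
    Equiv.swap_apply_of_ne_of_ne (show (3 : Fin 4) ≠ 0 by decide) (show (3 : Fin 4) ≠ 1 by decide),
    finSuccEquiv_X_zero, h2, h3, map_add, map_pow]
  ring

/-- **`F_d` is prime** in `k[x₀, …, x₃]` for `k` algebraically closed with `d ≠ 0` in `k`: after `x₀ ↔ x₁` it is
`Yᵈ + C(y₁ᵈ + y₂ᵈ)`, Eisenstein at the point `(0, ζ, 1)`, `ζᵈ = −1` (`irreducible_X_pow_add_C`; polynomial rings are factorial).
[folklore; Hartshorne I Ex. 5.5] -/
theorem prime_form [IsAlgClosed k] (hdk : (d : k) ≠ 0) : Prime (form k d) := by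
  have hd1 : 1 ≤ d := Nat.one_le_iff_ne_zero.mpr (by rintro rfl; exact hdk (by simp))
  obtain ⟨ζ, hζ⟩ := IsAlgClosed.exists_pow_nat_eq (-1 : k) (n := d) hd1
  have hζ0 : ζ ≠ 0 := by
    rintro rfl
    rw [zero_pow (by omega)] at hζ
    exact one_ne_zero (neg_eq_zero.mp hζ.symm)
  have hirr : Irreducible (rename (Equiv.swap (0 : Fin 4) 1) (form k d)) := by
    rw [← MulEquiv.irreducible_iff (finSuccEquiv k 3), finSuccEquiv_rename_form]
    refine irreducible_X_pow_add_C hd1 _ ![0, ζ, 1] ?_ 1 ?_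
    · simp [hζ]
    · have h : (pderiv 1 : Derivation k (MvPolynomial (Fin 3) k) (MvPolynomial (Fin 3) k)) (X 1 ^ d + X 2 ^ d) =
          (d : MvPolynomial (Fin 3) k) * X 1 ^ (d - 1) := by
        simp [Derivation.leibniz_pow, pderiv_X_of_ne (show (2 : Fin 3) ≠ 1 by decide), smul_eq_mul, nsmul_eq_mul]
      rw [h]
      simp only [map_mul, map_natCast, map_pow, MvPolynomial.eval_X, Matrix.cons_val_one, Matrix.cons_val_zero]
      exact mul_ne_zero hdk (pow_ne_zero _ hζ0)
  have hirr' : Irreducible (form k d) :=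
    (MulEquiv.irreducible_iff (renameEquiv k (Equiv.swap (0 : Fin 4) 1)).toMulEquiv (x := form k d)).mp hirr
  exact UniqueFactorizationMonoid.irreducible_iff_prime.mp hirr'

/-! ## The dehomogenized equations -/

/-- `F_d(x₀ := 1) = y₀ᵈ + y₁ᵈ + y₂ᵈ` in `k[y] = k[x₁, x₂, x₃]` (the vertex chart). [folklore] -/
theorem dehomogenize_form_zero :
    dehomogenize k (0 : Fin 4) (form k d) = (X 0 ^ d + X 1 ^ d + X 2 ^ d : MvPolynomial (Fin 3) k) := by
  simp only [form, map_add, map_pow, WhitneyCubic.dehomogenize_X_of_eq k 0 1 0 (by decide),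
    WhitneyCubic.dehomogenize_X_of_eq k 0 2 1 (by decide), WhitneyCubic.dehomogenize_X_of_eq k 0 3 2 (by decide)]

/-- `F_d(x₁ := 1) = 1 + y₁ᵈ + y₂ᵈ` (`y = (x₀, x₂, x₃)`). [folklore] -/
theorem dehomogenize_form_one :
    dehomogenize k (1 : Fin 4) (form k d) = (1 + X 1 ^ d + X 2 ^ d : MvPolynomial (Fin 3) k) := by
  simp only [form, map_add, map_pow, dehomogenize_X_self, one_pow,
    WhitneyCubic.dehomogenize_X_of_eq k 1 2 1 (by decide), WhitneyCubic.dehomogenize_X_of_eq k 1 3 2 (by decide)]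

/-- `F_d(x₂ := 1) = 1 + y₁ᵈ + y₂ᵈ` (`y = (x₀, x₁, x₃)`; `y₁ᵈ + 1 + y₂ᵈ` reordered). [folklore] -/
theorem dehomogenize_form_two :
    dehomogenize k (2 : Fin 4) (form k d) = (1 + X 1 ^ d + X 2 ^ d : MvPolynomial (Fin 3) k) := by
  simp only [form, map_add, map_pow, dehomogenize_X_self, one_pow,
    WhitneyCubic.dehomogenize_X_of_eq k 2 1 1 (by decide), WhitneyCubic.dehomogenize_X_of_eq k 2 3 2 (by decide)]
  ring

/-- `F_d(x₃ := 1) = 1 + y₁ᵈ + y₂ᵈ` (`y = (x₀, x₁, x₂)`; `y₁ᵈ + y₂ᵈ + 1` reordered). [folklore] -/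
theorem dehomogenize_form_three :
    dehomogenize k (3 : Fin 4) (form k d) = (1 + X 1 ^ d + X 2 ^ d : MvPolynomial (Fin 3) k) := by
  simp only [form, map_add, map_pow, dehomogenize_X_self, one_pow,
    WhitneyCubic.dehomogenize_X_of_eq k 3 1 1 (by decide), WhitneyCubic.dehomogenize_X_of_eq k 3 2 2 (by decide)]
  ring

/-- For `c ≠ 0`, `F_d(x_c := 1) = 1 + y₁ᵈ + y₂ᵈ` (the vertex is not on these charts). [folklore] -/
theorem dehomogenize_form_of_ne_zero (c : Fin 4) (hc : c ≠ 0) :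
    dehomogenize k c (form k d) = (1 + X 1 ^ d + X 2 ^ d : MvPolynomial (Fin 3) k) := by
  fin_cases c
  · exact absurd rfl hc
  · exact dehomogenize_form_one k d
  · exact dehomogenize_form_two k d
  · exact dehomogenize_form_three k d

/-! ## The hypersurface `H_d = V₊(F_d)` is integral -/

/-- `H_d = V₊(F_d)` (reduced induced structure) is reduced. [folklore] -/
theorem isReduced_hypersurface : AlgebraicGeometry.IsReduced (hypersurface (form k d)).left :=
  Literature.AlgebraicGeometry.Resolution.ComponentGluing.isReduced_subscheme_vanishingIdeal (zeroLocusClosed (form k d))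

/-- **`H_d = V₊(F_d)` is an integral scheme** for `k` algebraically closed with `d ≠ 0` in `k` (`F_d` prime ⇒ `V₊(F_d)` irreducible,
Hartshorne II Ex. 2.9; reduced by construction). [folklore] -/
theorem isIntegral_hypersurface [IsAlgClosed k] (hdk : (d : k) ≠ 0) :
    AlgebraicGeometry.IsIntegral (hypersurface (form k d)).left := by
  haveI := isReduced_hypersurface k d
  have hirr : IsIrreducible (Set.range (hypersurfaceι (form k d)).left) := by
    rw [range_hypersurfaceι]
    exact isIrreducible_zeroLocus_of_prime _ (isHomogeneous_form k d) (prime_form k d hdk)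
  haveI : IrreducibleSpace (Set.range (hypersurfaceι (form k d)).left) := Subtype.irreducibleSpace hirr
  haveI : IrreducibleSpace (hypersurface (form k d)).left :=
    (hypersurfaceι (form k d)).left.isClosedEmbedding.isEmbedding.toHomeomorph.irreducibleSpace_iff.mpr this
  exact AlgebraicGeometry.isIntegral_of_irreducibleSpace_of_isReduced _

end FermatCone

end Summit.ResolutionOfSingularities.ResolutionOfSingularities.Cruxes.EquisingularLiftNat.Sections

end
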